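import Literature.Geometry.Riemannian.KernelNashEntropy
import Literature.Analysis.Calculus.WindowTestMonotonicity
import Literature.MeasureTheory.Integral.IteratedIntegralDiracLimit
import HarnessLib

/-!
# Monotonicity of `∫∫ u(x,y,t) v₁(x,t) v₂(y,t) dV_t dV_t + c t` for conjugate heat flows `v₁, v₂`,
# from a DISTRIBUTIONAL supersolution inequality for `u` (the analytic step of Bamler 2020a,
# Cor. 3.6: `t ↦ Var_t(μ_{1,t}, μ_{2,t}) + H_n t` is non-decreasing)

R. Bamler, *Entropy and heat kernel bounds on a Ricci flow background*, arXiv:2008.07093 (2020a),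
Cor. 3.6 (Cor. 8 of the arXiv numbering): for nonnegative conjugate heat flows `v₁, v₂` of unit
mass along a (super) Ricci flow on a compact manifold, `t ↦ Var_t(v₁ dg_t, v₂ dg_t) + H_n t` is
non-decreasing. The printed proof uses the estimate `(∂ₜ − Δ_x − Δ_y) d_t² ≥ −H_n` (Thm. 3.5) via
a heat flow on `M × M` and the maximum principle. Here we prove the DEDUCTION from a distributional
form of that estimate, for an arbitrary continuous kernel `u(x, y, t)` in place of `d_t²(x, y)`:

* `IsRicciFlow.integral_integral_mul_sub_ge_of_distributional` — if
  `∫_{(a,b)} ∫∫ u · (−∂ₜφ + (R_x + R_y)φ − Δ_xφ − Δ_yφ) dV_t dV_t dt ≥ −c ∫∫∫ φ dV_t dV_t dt` for all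
  smooth `φ(x, y, t) ≥ 0` vanishing for `t ∉ (a, b)` (the formal adjoint of `∂ₜ − Δ_x − Δ_y` for
  the measure `dV_t(x) dV_t(y) dt`, `∂ₜ dV_t = −R dV_t`), then for conjugate heat flows
  `v₁, v₂ ≥ 0` on `[a, b]` and `a < t₁ < t₂ < b`,
  `F(t₂) − F(t₁) ≥ −c m₁ m₂ (t₂ − t₁)`, `F(t) = ∫∫ u(x,y,t) v₁(t,x) v₂(t,y) dV_t(x) dV_t(y)`,
  `mᵢ = ∫ vᵢ dV` (constant masses).

Proof: test with `φ = v₁(x,t) v₂(y,t) χ(t)` for smooth windows `χ`; by the conjugate heat equations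
the bracket collapses to `−χ′ v₁ v₂`, so the hypothesis reads `−c m₁m₂ ∫χ ≤ ∫ (−χ′) F`, and
`sub_ge_mul_of_forall_window` (`WindowTestMonotonicity.lean`) concludes. Everything is proved;
no definitions, no named facts (the distributional inequality is a HYPOTHESIS here).

## References

* R. H. Bamler, *Entropy and heat kernel bounds on a Ricci flow background*, arXiv:2008.07093
  (2020), §3, Thm. 3.5, Cor. 3.6. [Bamler2020Entropy]
-/

noncomputable section

open Bundle Set Function Filter Manifold MeasureTheory Measure TopologicalSpace
open scoped Manifold ContDiff Topology ENNReal NNReal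

namespace Literature.Geometry.Riemannian

open Lorentzian Lorentzian.PseudoRiemannianMetric Literature.Analysis.Calculus
  Literature.MeasureTheory.Integral

section Distributional

variable {m : ℕ} {H : Type*} [TopologicalSpace H]
  {I : ModelWithCorners ℝ (EuclideanSpace ℝ (Fin m)) H} [I.Boundaryless]
  {M : Type*} [TopologicalSpace M] [ChartedSpace H M] [IsManifold I ∞ M]
  [T2Space M] [CompactSpace M] [MeasurableSpace M] [BorelSpace M]
  {h : ℝ → PseudoRiemannianMetric I ∞ (EuclideanSpace ℝ (Fin m)) (TangentSpace I : M → Type _)}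
  {cov : ℝ → CovariantDerivative I (EuclideanSpace ℝ (Fin m)) (TangentSpace I : M → Type _)}

omit [I.Boundaryless] [T2Space M] in
/-- A parametric integral `p ↦ ∫ Φ(p, y) dμ(y)` of a continuous `Φ : P × M → ℝ` (`M` compact,
`μ` finite) is continuous (tube lemma). [folklore] -/
theorem continuous_integral_param {P : Type*} [TopologicalSpace P] (μ : Measure M)
    [IsFiniteMeasure μ] {Φ : P × M → ℝ} (hΦ : Continuous Φ) :
    Continuous fun p ↦ ∫ y, Φ (p, y) ∂μ := by
  have hΦ' : Continuous fun q : M × P ↦ Φ (q.2, q.1) := hΦ.comp (continuous_snd.prodMk continuous_fst)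
  have hint : ∀ p, Integrable (fun y ↦ Φ (p, y)) μ := fun p ↦
    (hΦ.comp (continuous_const.prodMk continuous_id)).integrable_of_hasCompactSupport
      (HasCompactSupport.of_compactSpace _)
  refine continuous_iff_continuousAt.2 fun p₀ ↦ ?_
  rw [ContinuousAt, Metric.tendsto_nhds]
  intro ε hε
  have hδ : 0 < ε / (μ.real univ + 1) := by positivity
  have hev := eventually_forall_abs_sub_lt (Φ := fun q : M × P ↦ Φ (q.2, q.1)) hΦ' p₀ hδ
  filter_upwards [hev] with p hp
  rw [Real.dist_eq, ← integral_sub (hint p) (hint p₀)]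
  have hb := norm_integral_le_of_norm_le_const (μ := μ) (f := fun y ↦ Φ (p, y) - Φ (p₀, y))
    (C := ε / (μ.real univ + 1)) (Eventually.of_forall fun y ↦ by
      rw [Real.norm_eq_abs]; exact (hp y).le)
  rw [Real.norm_eq_abs] at hb
  refine hb.trans_lt ?_
  rw [div_mul_eq_mul_div, div_lt_iff₀ (by positivity)]
  nlinarith [measureReal_nonneg (μ := μ) (s := univ)]

/-- **Variance-type monotonicity from a distributional supersolution inequality** (the deduction
of Bamler 2020a, Cor. 3.6 from Thm. 3.5, with the estimate for `d_t²` replaced by a hypothesis on a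
continuous kernel `u`). Let `(h, cov)` be a Ricci flow of Riemannian metrics on `[a, b]` on a
closed manifold modelled on `ℝᵐ`, `u(x, y, t)` continuous on `M × M × [a, b]`, and suppose that
for every smooth `φ(x, y, t) ≥ 0` vanishing for `t ∉ (a, b)`,
`−c ∫_{(a,b)} ∫∫ φ dV_t dV_t dt ≤ ∫_{(a,b)} ∫∫ u·(−∂ₜφ + (R_x+R_y)φ − Δ_xφ − Δ_yφ) dV_t dV_t dt`.
Then for conjugate heat flows `v₁, v₂ ≥ 0` on `[a, b]` and `a < t₁ < t₂ < b`,
`−c m₁ m₂ (t₂ − t₁) ≤ F(t₂) − F(t₁)` with `F(t) = ∫∫ u v₁ v₂ dV_t dV_t`, `mᵢ = ∫ vᵢ(b) dV_b`.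
[cite: Bamler2020Entropy, §3, Cor. 3.6] -/
theorem IsRicciFlow.integral_integral_mul_sub_ge_of_distributional {a b : ℝ} (hab : a < b)
    (hflow : IsRicciFlow h cov (Icc a b)) (hR' : ∀ r, (h r).IsRiemannian)
    {u : M → M → ℝ → ℝ}
    (huc : ContinuousOn (fun p : M × M × ℝ ↦ u p.1 p.2.1 p.2.2) (univ ×ˢ univ ×ˢ Icc a b))
    {c : ℝ}
    (hdist : ∀ φ : M → M → ℝ → ℝ,
      ContMDiff ((I.prod I).prod 𝓘(ℝ, ℝ)) 𝓘(ℝ, ℝ) ∞ (fun p : (M × M) × ℝ ↦ φ p.1.1 p.1.2 p.2) →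
      (∀ x y t, 0 ≤ φ x y t) → (∀ x y, ∀ t ∉ Ioo a b, φ x y t = 0) →
      -c * ∫ t in Ioo a b, ∫ x, ∫ y, φ x y t ∂(h t).riemVolume ∂(h t).riemVolume ≤
        ∫ t in Ioo a b, ∫ x, ∫ y, u x y t *
          (-deriv (fun s ↦ φ x y s) t +
            ((h t).scalarCurvatureWith (cov t) x + (h t).scalarCurvatureWith (cov t) y) * φ x y t -
            (h t).laplaceBeltrami (fun x' ↦ φ x' y t) x -
            (h t).laplaceBeltrami (fun y' ↦ φ x y' t) y) ∂(h t).riemVolume ∂(h t).riemVolume)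
    {v₁ v₂ : ℝ → M → ℝ} (hv₁ : IsConjugateHeatSolutionOn h cov (Icc a b) v₁)
    (hv₂ : IsConjugateHeatSolutionOn h cov (Icc a b) v₂)
    (hv₁0 : ∀ t ∈ Icc a b, ∀ x, 0 ≤ v₁ t x) (hv₂0 : ∀ t ∈ Icc a b, ∀ x, 0 ≤ v₂ t x)
    {t₁ t₂ : ℝ} (hat₁ : a < t₁) (h12 : t₁ < t₂) (ht₂b : t₂ < b) :
    -c * ((∫ x, v₁ b x ∂(h b).riemVolume) * ∫ y, v₂ b y ∂(h b).riemVolume) * (t₂ - t₁) ≤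
      (∫ x, ∫ y, u x y t₂ * (v₁ t₂ x * v₂ t₂ y) ∂(h t₂).riemVolume ∂(h t₂).riemVolume) -
        ∫ x, ∫ y, u x y t₁ * (v₁ t₁ x * v₂ t₁ y) ∂(h t₁).riemVolume ∂(h t₁).riemVolume := by
  haveI : ∀ r, IsFiniteMeasure (h r).riemVolume := fun r ↦ ⟨(h r).riemVolume_univ_lt_top⟩
  have hR : ∀ r ∈ Icc a b, (h r).IsRiemannian := fun r _ ↦ hR' r
  set m₁ : ℝ := ∫ x, v₁ b x ∂(h b).riemVolume with hm₁
  set m₂ : ℝ := ∫ y, v₂ b y ∂(h b).riemVolume with hm₂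
  set F : ℝ → ℝ := fun t ↦ ∫ x, ∫ y, u x y t * (v₁ t x * v₂ t y) ∂(h t).riemVolume ∂(h t).riemVolume
    with hF
  -- masses are constant
  have hmass₁ : ∀ t ∈ Icc a b, ∫ x, v₁ t x ∂(h t).riemVolume = m₁ := fun t ht ↦
    hflow.integral_conjugateHeat_eq (convex_Icc a b) hR hv₁.1 hv₁.2 ⟨hab.le, le_rfl⟩ ht
  have hmass₂ : ∀ t ∈ Icc a b, ∫ y, v₂ t y ∂(h t).riemVolume = m₂ := fun t ht ↦
    hflow.integral_conjugateHeat_eq (convex_Icc a b) hR hv₂.1 hv₂.2 ⟨hab.le, le_rfl⟩ ht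
  have h12T : Icc t₁ t₂ ⊆ Ioo a b := fun t ht ↦ ⟨hat₁.trans_le ht.1, ht.2.trans_lt ht₂b⟩
  ----------------------------------------------------------------
  -- (0) regularity of `v₁, v₂` at interior times
  ----------------------------------------------------------------
  have hO : IsOpen ((univ : Set M) ×ˢ Ioo a b) := isOpen_univ.prod isOpen_Ioo
  have hvsmooth : ∀ {v : ℝ → M → ℝ}, IsConjugateHeatSolutionOn h cov (Icc a b) v →
      ContMDiffOn (I.prod 𝓘(ℝ, ℝ)) 𝓘(ℝ, ℝ) ∞ (fun q : M × ℝ ↦ v q.2 q.1) (univ ×ˢ Ioo a b) :=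
    fun hv ↦ hv.1.mono (prod_mono le_rfl Ioo_subset_Icc_self)
  have hvslice : ∀ {v : ℝ → M → ℝ}, IsConjugateHeatSolutionOn h cov (Icc a b) v →
      ∀ t ∈ Icc a b, ContMDiff I 𝓘(ℝ, ℝ) ∞ (v t) := fun hv t ht ↦ contMDiff_slice_of_contMDiffOn hv.1 ht
  -- the time derivative at interior times is a genuine derivative
  have hvderiv : ∀ {v : ℝ → M → ℝ}, IsConjugateHeatSolutionOn h cov (Icc a b) v →
      ∀ t ∈ Ioo a b, ∀ x, HasDerivAt (fun s ↦ v s x)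
        (-(h t).laplaceBeltrami (v t) x + (h t).scalarCurvatureWith (cov t) x * v t x) t := by
    intro v hv t ht x
    have hxt : (x, t) ∈ (univ : Set M) ×ˢ Ioo a b := ⟨mem_univ _, ht⟩
    have hcurve : ContMDiffAt 𝓘(ℝ, ℝ) 𝓘(ℝ, ℝ) ∞ (fun s ↦ v s x) t :=
      ((hvsmooth hv).contMDiffAt (hO.mem_nhds hxt)).comp t (contMDiffAt_const.prodMk contMDiffAt_id)
    have hdiff : DifferentiableAt ℝ (fun s ↦ v s x) t :=
      (contMDiffAt_iff_contDiffAt.1 hcurve).differentiableAt (by simp)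
    have h1 := hdiff.hasDerivAt
    rwa [← hdiff.derivWithin (uniqueDiffOn_Icc hab t (Ioo_subset_Icc_self ht)),
      hv.2 t (Ioo_subset_Icc_self ht) x] at h1
  ----------------------------------------------------------------
  -- (1) continuity of `F` on `[t₁, t₂]`
  ----------------------------------------------------------------
  -- clamp the time variable into `[a, b]` to get globally continuous integrands
  set κ : ℝ → ℝ := fun t ↦ max a (min b t) with hκ
  have hκc : Continuous κ := continuous_const.max (continuous_const.min continuous_id)
  have hκmem : ∀ t, κ t ∈ Icc a b := fun t ↦
    ⟨le_max_left _ _, max_le hab.le (min_le_left _ _)⟩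
  have hκid : ∀ t ∈ Icc a b, κ t = t := fun t ht ↦ by
    rw [hκ]; simp only; rw [min_eq_right ht.2, max_eq_right ht.1]
  set ρ : M → ℝ → ℝ := fun x t ↦ (h t).densityRatio (h a) x with hρ
  have hρc : Continuous fun q : M × ℝ ↦ ρ q.1 (κ q.2) := by
    have h1 := (hflow.smooth.contMDiffOn_densityRatio (g₀ := h a) hR (hR' a)).continuousOn
    rw [hρ]
    exact h1.comp_continuous (continuous_fst.prodMk (hκc.comp continuous_snd))
      fun q ↦ ⟨mem_univ _, hκmem q.2⟩
  clear_value κ ρ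
  have hvc : ∀ {v : ℝ → M → ℝ}, IsConjugateHeatSolutionOn h cov (Icc a b) v →
      Continuous fun q : M × ℝ ↦ v (κ q.2) q.1 := fun hv ↦
    hv.1.continuousOn.comp_continuous (continuous_fst.prodMk (hκc.comp continuous_snd))
      fun q ↦ ⟨mem_univ _, hκmem q.2⟩
  have huc' : Continuous fun p : M × M × ℝ ↦ u p.1 p.2.1 (κ p.2.2) :=
    huc.comp_continuous (continuous_fst.prodMk ((continuous_fst.comp continuous_snd).prodMk
      (hκc.comp (continuous_snd.comp continuous_snd))))
      fun p ↦ ⟨mem_univ _, mem_univ _, hκmem p.2.2⟩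
  -- `F t = ∫ (∫ Ψ) dV_a dV_a` with `Ψ` continuous, for `t ∈ [a, b]`
  have hΨc : Continuous fun q : (M × ℝ) × M ↦
      u q.1.1 q.2 (κ q.1.2) * (v₁ (κ q.1.2) q.1.1 * v₂ (κ q.1.2) q.2) * ρ q.2 (κ q.1.2) := by
    refine Continuous.mul (Continuous.mul ?_ (Continuous.mul ?_ ?_)) ?_
    · exact huc'.comp (continuous_fst.fst.prodMk (continuous_snd.prodMk continuous_fst.snd))
    · exact (hvc hv₁).comp (continuous_fst.fst.prodMk continuous_fst.snd)
    · exact (hvc hv₂).comp (continuous_snd.prodMk continuous_fst.snd)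
    · exact hρc.comp (continuous_snd.prodMk continuous_fst.snd)
  have hG : Continuous fun q : M × ℝ ↦ ∫ y,
      u q.1 y (κ q.2) * (v₁ (κ q.2) q.1 * v₂ (κ q.2) y) * ρ y (κ q.2) ∂(h a).riemVolume :=
    continuous_integral_param (P := M × ℝ) ((h a).riemVolume) hΨc
  have hΘc : Continuous fun q : ℝ × M ↦ (∫ y,
      u q.2 y (κ q.1) * (v₁ (κ q.1) q.2 * v₂ (κ q.1) y) * ρ y (κ q.1) ∂(h a).riemVolume) * ρ q.2 (κ q.1) := by
    refine Continuous.mul ?_ ?_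
    · exact hG.comp (continuous_snd.prodMk continuous_fst)
    · exact hρc.comp (continuous_snd.prodMk continuous_fst)
  have hFc' : Continuous fun t ↦ ∫ x, (∫ y,
      u x y (κ t) * (v₁ (κ t) x * v₂ (κ t) y) * ρ y (κ t) ∂(h a).riemVolume) * ρ x (κ t)
      ∂(h a).riemVolume :=
    continuous_integral_param (P := ℝ) ((h a).riemVolume) hΘc
  have hFeq : ∀ t ∈ Icc a b, F t = ∫ x, (∫ y,
      u x y (κ t) * (v₁ (κ t) x * v₂ (κ t) y) * ρ y (κ t) ∂(h a).riemVolume) * ρ x (κ t)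
      ∂(h a).riemVolume := by
    intro t ht
    simp only [hF, hρ, hκid t ht]
    rw [integral_riemVolume_eq_integral_mul_densityRatio (hR' t) (hR' a)]
    refine integral_congr_ae (Eventually.of_forall fun x ↦ ?_)
    dsimp only
    rw [integral_riemVolume_eq_integral_mul_densityRatio (hR' t) (hR' a)]
  have hFc : ContinuousOn F (Icc t₁ t₂) :=
    (hFc'.continuousOn.congr fun t ht ↦ hFeq t (Ioo_subset_Icc_self (h12T ht))).mono le_rfl
  ----------------------------------------------------------------
  -- (2) the window hypothesis
  ----------------------------------------------------------------
  refine sub_ge_mul_of_forall_window h12 hFc fun χ hχs hχ0 hχ1 hχl hχr ↦ ?_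
  -- the test function `φ = v₁(x,t) v₂(y,t) χ(t)`
  set φ : M → M → ℝ → ℝ := fun x y t ↦ v₁ t x * v₂ t y * χ t with hφ
  have hχ0' : ∀ t ∉ Ioo t₁ t₂, χ t = 0 := fun t ht ↦ by
    rcases le_or_gt t t₁ with h1 | h1
    · exact hχl t h1
    · exact hχr t (not_lt.1 fun h2 ↦ ht ⟨h1, h2⟩)
  -- smoothness of `φ` on `(M × M) × ℝ`
  have hφs : ContMDiff ((I.prod I).prod 𝓘(ℝ, ℝ)) 𝓘(ℝ, ℝ) ∞ fun p : (M × M) × ℝ ↦ φ p.1.1 p.1.2 p.2 := by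
    intro p
    by_cases hp : p.2 ∈ Ioo a b
    · -- near `p` the product formula is smooth
      have hA : IsOpen {q : (M × M) × ℝ | q.2 ∈ Ioo a b} := isOpen_Ioo.preimage continuous_snd
      have hmem : {q : (M × M) × ℝ | q.2 ∈ Ioo a b} ∈ 𝓝 p := hA.mem_nhds hp
      have h1 : ContMDiffOn ((I.prod I).prod 𝓘(ℝ, ℝ)) 𝓘(ℝ, ℝ) ∞
          (fun q : (M × M) × ℝ ↦ v₁ q.2 q.1.1) {q | q.2 ∈ Ioo a b} :=
        (hvsmooth hv₁).comp (contMDiff_fst.fst.prodMk contMDiff_snd).contMDiffOn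
          fun q hq ↦ ⟨mem_univ _, hq⟩
      have h2 : ContMDiffOn ((I.prod I).prod 𝓘(ℝ, ℝ)) 𝓘(ℝ, ℝ) ∞
          (fun q : (M × M) × ℝ ↦ v₂ q.2 q.1.2) {q | q.2 ∈ Ioo a b} :=
        (hvsmooth hv₂).comp (contMDiff_fst.snd.prodMk contMDiff_snd).contMDiffOn
          fun q hq ↦ ⟨mem_univ _, hq⟩
      have h3 : ContMDiff ((I.prod I).prod 𝓘(ℝ, ℝ)) 𝓘(ℝ, ℝ) ∞ fun q : (M × M) × ℝ ↦ χ q.2 :=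
        hχs.contMDiff.comp contMDiff_snd
      exact ((h1.mul h2).mul h3.contMDiffOn).contMDiffAt hmem
    · -- near `p` (with `p.2 ∉ (a,b)`, hence `p.2 < t₁` or `p.2 > t₂`) `φ = 0`
      have hcase : p.2 < t₁ ∨ t₂ < p.2 := by
        rcases not_and_or.1 (fun h' : a < p.2 ∧ p.2 < b ↦ hp h') with h1 | h1
        · exact Or.inl ((not_lt.1 h1).trans_lt hat₁)
        · exact Or.inr (ht₂b.trans_le (not_lt.1 h1))
      have hmem : {q : (M × M) × ℝ | q.2 < t₁ ∨ t₂ < q.2} ∈ 𝓝 p :=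
        ((isOpen_Iio.union isOpen_Ioi).preimage continuous_snd).mem_nhds hcase
      have hev : (fun p : (M × M) × ℝ ↦ φ p.1.1 p.1.2 p.2) =ᶠ[𝓝 p] fun _ ↦ (0 : ℝ) :=
        eventuallyEq_of_mem hmem fun q hq ↦ by
          show φ q.1.1 q.1.2 q.2 = (0 : ℝ)
          have : χ q.2 = 0 := hχ0' q.2 fun h' ↦ by
            rcases hq with hq | hq
            · exact lt_irrefl _ (hq.trans h'.1)
            · exact lt_irrefl _ (h'.2.trans hq)
          simp [hφ, this]
      exact contMDiffAt_const.congr_of_eventuallyEq hev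
  have hφ0 : ∀ x y t, 0 ≤ φ x y t := by
    intro x y t
    by_cases ht : t ∈ Ioo t₁ t₂
    · exact mul_nonneg (mul_nonneg (hv₁0 t (Ioo_subset_Icc_self (h12T (Ioo_subset_Icc_self ht))) x)
        (hv₂0 t (Ioo_subset_Icc_self (h12T (Ioo_subset_Icc_self ht))) y)) (hχ0 t)
    · simp [hφ, hχ0' t ht]
  have hφT : ∀ x y, ∀ t ∉ Ioo a b, φ x y t = 0 := fun x y t ht ↦ by
    have : χ t = 0 := hχ0' t fun h' ↦ ht (h12T (Ioo_subset_Icc_self h'))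
    simp [hφ, this]
  have key := hdist φ hφs hφ0 hφT
  -- derivative of `χ`
  have hχd : ∀ t, HasDerivAt χ (deriv χ t) t := fun t ↦
    ((hχs.differentiable (by simp)).differentiableAt).hasDerivAt
  have hχ'0 : ∀ t ∈ Ioo a b, t ∉ Icc t₁ t₂ → deriv χ t = 0 := by
    intro t _ ht
    rcases lt_or_ge t t₁ with h1 | h1
    · have hev : χ =ᶠ[𝓝 t] fun _ ↦ 0 := by
        filter_upwards [Iio_mem_nhds h1] with s hs using hχl s hs.le
      rw [hev.deriv_eq, deriv_const]
    · have h2 : t₂ < t := not_le.1 fun h' ↦ ht ⟨h1, h'⟩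
      have hev : χ =ᶠ[𝓝 t] fun _ ↦ 0 := by
        filter_upwards [Ioi_mem_nhds h2] with s hs using hχr s hs.le
      rw [hev.deriv_eq, deriv_const]
  ----------------------------------------------------------------
  -- (3) the two sides of `key`
  ----------------------------------------------------------------
  -- left: `∫∫ φ dV dV = χ t m₁ m₂`
  have hL : ∀ t ∈ Ioo a b, ∫ x, ∫ y, φ x y t ∂(h t).riemVolume ∂(h t).riemVolume = m₁ * m₂ * χ t := by
    intro t ht
    have ht' := Ioo_subset_Icc_self ht
    simp only [hφ]
    have e1 : ∀ x, ∫ y, v₁ t x * v₂ t y * χ t ∂(h t).riemVolume = v₁ t x * (m₂ * χ t) := by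
      intro x
      have : (fun y ↦ v₁ t x * v₂ t y * χ t) = fun y ↦ (v₁ t x * χ t) * v₂ t y := by funext y; ring
      rw [this, integral_const_mul, hmass₂ t ht']; ring
    simp_rw [e1]
    rw [integral_mul_const, hmass₁ t ht']; ring
  -- right: the bracket is `−χ′ v₁ v₂`
  have hB : ∀ t ∈ Ioo a b, ∀ x y,
      -deriv (fun s ↦ φ x y s) t +
        ((h t).scalarCurvatureWith (cov t) x + (h t).scalarCurvatureWith (cov t) y) * φ x y t -
        (h t).laplaceBeltrami (fun x' ↦ φ x' y t) x - (h t).laplaceBeltrami (fun y' ↦ φ x y' t) y =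
      -deriv χ t * (v₁ t x * v₂ t y) := by
    intro t ht x y
    have ht' := Ioo_subset_Icc_self ht
    have h2 : (2 : ℕ∞ω) ≤ (∞ : ℕ∞ω) := WithTop.coe_le_coe.mpr le_top
    -- time derivative of the product
    have hd := ((hvderiv hv₁ t ht x).mul (hvderiv hv₂ t ht y)).mul (hχd t)
    have hd' : deriv (fun s ↦ φ x y s) t =
        ((-(h t).laplaceBeltrami (v₁ t) x + (h t).scalarCurvatureWith (cov t) x * v₁ t x) * v₂ t y +
          v₁ t x * (-(h t).laplaceBeltrami (v₂ t) y + (h t).scalarCurvatureWith (cov t) y * v₂ t y)) *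
          χ t + v₁ t x * v₂ t y * deriv χ t := hd.deriv
    -- Laplacians of the slices
    have hL₁ : (h t).laplaceBeltrami (fun x' ↦ φ x' y t) x = (v₂ t y * χ t) * (h t).laplaceBeltrami (v₁ t) x := by
      have e : (fun x' ↦ φ x' y t) = fun x' ↦ (v₂ t y * χ t) * v₁ t x' := by funext x'; simp [hφ]; ring
      rw [e, laplaceBeltrami_const_mul (h t) (((hvslice hv₁ t ht').of_le h2).contMDiffAt)]
    have hL₂ : (h t).laplaceBeltrami (fun y' ↦ φ x y' t) y = (v₁ t x * χ t) * (h t).laplaceBeltrami (v₂ t) y := by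
      have e : (fun y' ↦ φ x y' t) = fun y' ↦ (v₁ t x * χ t) * v₂ t y' := by funext y'; simp [hφ]; ring
      rw [e, laplaceBeltrami_const_mul (h t) (((hvslice hv₂ t ht').of_le h2).contMDiffAt)]
    rw [hd', hL₁, hL₂]
    simp only [hφ]
    ring
  have hRHS : ∀ t ∈ Ioo a b, ∫ x, ∫ y, u x y t *
      (-deriv (fun s ↦ φ x y s) t +
        ((h t).scalarCurvatureWith (cov t) x + (h t).scalarCurvatureWith (cov t) y) * φ x y t -
        (h t).laplaceBeltrami (fun x' ↦ φ x' y t) x - (h t).laplaceBeltrami (fun y' ↦ φ x y' t) y)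
        ∂(h t).riemVolume ∂(h t).riemVolume = -deriv χ t * F t := by
    intro t ht
    have e : ∀ x, (fun y ↦ u x y t * (-deriv (fun s ↦ φ x y s) t +
        ((h t).scalarCurvatureWith (cov t) x + (h t).scalarCurvatureWith (cov t) y) * φ x y t -
        (h t).laplaceBeltrami (fun x' ↦ φ x' y t) x - (h t).laplaceBeltrami (fun y' ↦ φ x y' t) y)) =
        fun y ↦ -deriv χ t * (u x y t * (v₁ t x * v₂ t y)) := by
      intro x; funext y; rw [hB t ht x y]; ring
    simp_rw [e, integral_const_mul]
    rfl
  -- rewrite `key`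
  have hkeyL : ∫ t in Ioo a b, ∫ x, ∫ y, φ x y t ∂(h t).riemVolume ∂(h t).riemVolume =
      m₁ * m₂ * ∫ t in Icc t₁ t₂, χ t := by
    rw [setIntegral_congr_fun measurableSet_Ioo hL, integral_const_mul]
    congr 1
    exact setIntegral_eq_of_subset_of_forall_sdiff_eq_zero measurableSet_Ioo h12T
      fun t ht ↦ hχ0' t fun h' ↦ ht.2 (Ioo_subset_Icc_self h')
  have hkeyR : ∫ t in Ioo a b, ∫ x, ∫ y, u x y t *
      (-deriv (fun s ↦ φ x y s) t +
        ((h t).scalarCurvatureWith (cov t) x + (h t).scalarCurvatureWith (cov t) y) * φ x y t -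
        (h t).laplaceBeltrami (fun x' ↦ φ x' y t) x - (h t).laplaceBeltrami (fun y' ↦ φ x y' t) y)
        ∂(h t).riemVolume ∂(h t).riemVolume = ∫ t in Icc t₁ t₂, -deriv χ t * F t := by
    rw [setIntegral_congr_fun measurableSet_Ioo hRHS]
    refine setIntegral_eq_of_subset_of_forall_sdiff_eq_zero measurableSet_Ioo h12T fun t ht ↦ ?_
    rw [hχ'0 t ht.1 ht.2]; ring
  rw [hkeyL, hkeyR] at key
  calc -c * (m₁ * m₂) * ∫ t in Icc t₁ t₂, χ t = -c * (m₁ * m₂ * ∫ t in Icc t₁ t₂, χ t) := by ring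
    _ ≤ _ := key

end Distributional

end Literature.Geometry.Riemannian

end
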